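import Summits.ABC.IUTFork.Conditional.WRowHexLamSevenWholeLe24
import Summits.ABC.IUTFork.Conditional.WRowHexLamSevenTwentyFiveAllLevels
import Summits.ABC.IUTFork.Conditional.WRowHexLamSevenTwentySixAllLevels
import Summits.ABC.IUTFork.Conditional.WRowHexLamSevenTwentySevenAllLevels
import Summits.ABC.IUTFork.Conditional.WRowHexLamSevenTwentyEightAllLevels
import Summits.ABC.IUTFork.Conditional.WRowHexLamSevenTwentyNineAllLevels
import Summits.ABC.IUTFork.Conditional.WRowHexLamSevenThirtyAllLevels
import Summits.ABC.IUTFork.Conditional.WRowHexLamSevenThirtyOneAllLevels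
import Summits.ABC.IUTFork.Conditional.WRowHexLamSevenThirtyTwoAllLevels
import Summits.ABC.IUTFork.Conditional.WRowHexLamSevenThirtyThreeAllLevels
import Summits.ABC.IUTFork.Conditional.WRowHexLamSevenThirtyFourAllLevels
import Summits.ABC.IUTFork.Conditional.WRowHexLamSevenThirtyFiveAllLevels
import Summits.ABC.IUTFork.Conditional.WRowHexLamSevenThirtySixAllLevels
import Summits.ABC.IUTFork.Conditional.WRowHexLamSevenThirtySevenAllLevels
import Summits.ABC.IUTFork.Conditional.WRowHexLamSevenThirtyEightAllLevels
import Summits.ABC.IUTFork.Conditional.WRowHexLamSevenThirtyNineAllLevels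
import Summits.ABC.IUTFork.Conditional.WRowHexLamSevenFortyAllLevels
import Summits.ABC.IUTFork.Conditional.WRowHexLamSevenTwentyFiveRefutedBand
import Summits.ABC.IUTFork.Conditional.WRowHexLamSevenTwentySixRefutedBand
import Summits.ABC.IUTFork.Conditional.WRowHexLamSevenTwentySevenRefutedBand
import Summits.ABC.IUTFork.Conditional.WRowHexLamSevenTwentyEightRefutedBand
import Summits.ABC.IUTFork.Conditional.WRowHexLamSevenTwentyNineRefutedBand
import Summits.ABC.IUTFork.Conditional.WRowHexLamSevenThirtyRefutedBand
import Summits.ABC.IUTFork.Conditional.WRowHexLamSevenThirtyOneRefutedBand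
import Summits.ABC.IUTFork.Conditional.WRowHexLamSevenThirtyTwoRefutedBand
import Summits.ABC.IUTFork.Conditional.WRowHexLamSevenThirtyThreeRefutedBand
import Summits.ABC.IUTFork.Conditional.WRowHexLamSevenThirtyFourRefutedBand
import Summits.ABC.IUTFork.Conditional.WRowHexLamSevenThirtyFiveRefutedBand
import Summits.ABC.IUTFork.Conditional.WRowHexLamSevenThirtySixRefutedBand
import Summits.ABC.IUTFork.Conditional.WRowHexLamSevenThirtySevenRefutedBand
import Summits.ABC.IUTFork.Conditional.WRowHexLamSevenThirtyEightRefutedBand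
import Summits.ABC.IUTFork.Conditional.WRowHexLamSevenThirtyNineRefutedBand
import Summits.ABC.IUTFork.Conditional.WRowHexLamSevenFortyRefutedBand
import Summits.ABC.IUTFork.Conditional.WRowHexLamSevenThirtyLevel4069338436831
import HarnessLib

/-!
# R-W WINDOW numerics («W:HEX-UNIFORM-K» U3′): «HEX WHOLE k = 1…40 UNDER ONE THEOREM NAME» — the 40 decided HEX axes
# `λ_k = 1/2 + 2/7^k`, `k = 1…40`, packaged with the `(k, L₀(k), L⁺(k))` table IN THE BINDER

PROOF-ONLY file (D-0012; 0 definitions, 0 `Prop` facts, no instance, no notation) of the abc-iut cell — branch C certificate seat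
abc-iut-C-cert-1 (gen 9), continuation of row «W:HEX-UNIFORM-K» U3 after «W:HEX-AXIS-REST-3» / «W:HEX-AXIS-REST-4» (STATUS 13:58:09Z / 15:12:09Z). TAKES NO SIDE on
[IUTchIII] Cor. 3.12 (S. Mochizuki, *Inter-universal Teichmüller theory III*, Cor. 3.12 p. 173–174; Step (xi-f) p. 184) or on any author;
«refuted / inhabited as typed» ≠ «refuted / asserted in print». THIS FILE: ONE packaging theorem **`WRow.hex_whole_le_40`** extending `WRow.hex_whole_le_24` (p530248, rows `k ≤ 24` BY NAME through it) by the sixteen axes `k = 25…40`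
(abc-iut-w6-d055 g16 «W:HEX-AXIS-REST-3» k = 25…32, abc-iut-C-cert-1 g9 «W:HEX-AXIS-REST-4» k = 33…40, abc-iut-W-neg-1's ceiling level at `(30, 4069338436831)`): for `(k, L₀, L⁺)`
in the 40-row list literal of its binder, every prime `l ≥ 11` and every genuine Θ-volume datum `T` over `(ratPoint (1/2 + 2/7^k), l)`:
`(l ≤ L₀ → ¬S_H in the K-line shape (chosen realising ideles, pinned q-reading))` ∧ `(L⁺ ≤ l → S_H: Licence at settingPrVolSharp for EVERY pair of realising ideles)`.
THE SIXTEEN NEW ROWS (four desks agree: abc-iut-W-num-5 engine C = A = B `XC-HEX-AXIS-k9-40.tsv`, w6-d055 g16, C-cert-1 g9): `k = 25`: `(3460321741, 3460321747)` · `k = 26`: `(5536514639, 5536514681)` · `k = 27`: `(14533351453, 14533351507)` · `k = 28`: `(38755603903, 38755603927)` · `k = 29`: `(33911153561, 33911153599)` · `k = 30`: `(4069338436799, 4069338436831)` · `k = 31`: `(237378075419, 237378075439)` · `k = 32`: `(1899024603689, 1899024603703)` · `k = 33`: `(4984939585357, 4984939585387)` · `k = 34`: `(13293172227497, 13293172227557)`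 · `k = 35`: `(58157628496679, 58157628496739)` · `k = 36`: `(279156616784327, 279156616784387)` · `k = 37`: `(81420679895431, 81420679895459)` · `k = 38`: `(651365439163823, 651365439163849)` · `k = 39`: `(1709834277805873, 1709834277805961)` · `k = 40`: `(22797790370745883, 22797790370745947)`; `k = 30`: the
INHABITED side STARTS AT THE CEILING-ONLY LEVEL `4069338436831` (abc-iut-W-neg-1's `WRow.licence_lamSeven_thirty_level4069338436831`; w6-d055's `…_thirty_all`
from `4069338436847`) — the shape the files give, as for `k = 10, 18` in `WRow.hex_whole_le_24`. For EVERY row no prime lies strictly between `L₀` and `L⁺`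
(desk; `4069338436832…4069338436846` composite: least factors 2, 3, 5, 521, 3, 71, 43, 3), so each axis `k = 1…40` is DECIDED AS TYPED AT EVERY PRIME `l ≥ 11`.
HONEST SCOPE: OUR sharp containers and Dupuy–Hilado's typed (Ind1)/(Ind2); the per-label licence is a STRONGER-THAN-PRINT sufficient form of Step (xi-f);
admissibility / Szpiro-badness / (P6) of `(ratPoint λ_k, l)` and NON-EMPTINESS of the datum type are NOT claimed; nothing about the printed inequality, the
number-level `Cor22.Cor312AtDatum` or any author's intended hull; typed ≠ proved; instantiated ≠ endorsed; no abc claim.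
[cite: Mochizuki2012, IUTchI Def. 3.1 (b),(c) pp. 61–62, Ex. 3.2 (iv) p. 71; IUTchIII Cor. 3.12 Step (xi-d) p. 183, (xi-f) p. 184; IUTchIV Prop. 1.2 (i)(ii) p. 10, Prop. 1.4 (ii) p. 13, Cor. 2.2 (ii) proof (P5) p. 46] [cite: DupuyHilado2025, §3.3, §3.4, §4.9, §4.12] [claim: Mochizuki2012, status: disputed] for every IUT sentence quoted.
-/

noncomputable section

open Set Function Metric NumberField IsDedekindDomain

namespace Summit.ABC.IUTFork.Conditional

open Thm311 Thm311.Real Cor312 Cor312Vol Cor312Prov Literature.IUT.LogThetaLattice Literature.IUT.LogVolume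
  Literature.IUT.HodgeTheaters Literature.IUT.LogVolume.Cor22
open Literature.NumberTheory.NumberFields Literature.NumberTheory.GaloisRepresentations.Ultrametric
open Literature.NumberTheory.DiophantineGeometry Literature.NumberTheory.DiophantineGeometry.GenEll

open Summit.ABC.IUTFork.Repair.RH.HullThresholdExact

/-- **«HEX WHOLE k = 1…40 UNDER ONE THEOREM NAME».** For every row `(k, L₀, L⁺)` of the 40-row list literal below, every prime `l ≥ 11` and every
genuine Θ-volume datum `T` over `(ratPoint (1/2 + 2/7^k), l)`: (1) if `l ≤ L₀`, S_H FAILS in the K-line shape (CHOSEN realising ideles, pinned q-reading);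
(2) if `L⁺ ≤ l`, S_H HOLDS for EVERY pair of realising Θ- and q-ideles. Rows `k ≤ 24` by `WRow.hex_whole_le_24` BY NAME; rows `k = 25…40` by the
REF glue `GenuineK.…_<k>_le` and the INH bands `WRow.licence_lamSeven_<k>_all` of w6-d055 g16 / C-cert-1 g9 (+ W-neg-1's level `(30, 4069338436831)`).
[cite: Mochizuki2012, IUTchI Def. 3.1 (b),(c) pp. 61–62, Ex. 3.2 (iv) p. 71; IUTchIII Cor. 3.12 Step (xi-d) p. 183, (xi-f) p. 184; IUTchIV Prop. 1.2 (i)(ii) p. 10, Prop. 1.4 (ii) p. 13, Cor. 2.2 (ii) proof (P5) p. 46] [cite: DupuyHilado2025, §3.3, §3.4, §4.9, §4.12] [claim: Mochizuki2012, status: disputed] -/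
theorem WRow.hex_whole_le_40 {k L0 Lp l : ℕ}
    (hmem : (k, L0, Lp) ∈ ([(1, 10, 11), (2, 10, 11), (3, 10, 11), (4, 10, 11), (5, 10, 11), (6, 10, 11), (7, 10, 11), (8, 71, 73), (9, 337, 347), (10, 4721, 4723), (11, 811, 821), (12, 20063, 20071), (13, 5851, 5857), (14, 46933, 46957), (15, 617587, 617647), (16, 329269, 329281), (17, 288203, 288209), (18, 6917593, 6917611), (19, 2017637, 2017643), (20, 80707019, 80707051), (21, 42371239, 42371257), (22, 112989881, 112989913), (23, 98866283, 98866289), (24, 2372791879, 2372791903), (25, 3460321741, 3460321747), (26, 5536514639, 5536514681), (27, 14533351453, 14533351507), (28, 38755603903, 38755603927), (29, 33911153561, 33911153599), (30, 4069338436799, 4069338436831), (31, 237378075419, 237378075439), (32, 1899024603689, 1899024603703), (33, 4984939585357, 4984939585387), (34, 13293172227497, 13293172227557), (35, 58157628496679, 58157628496739), (36, 279156616784327, 279156616784387), (37, 81420679895431, 81420679895459), (38, 651365439163823, 651365439163849), (39, 1709834277805873, 1709834277805961), (40, 22797790370745883, 22797790370745947)] : List (ℕ × ℕ × ℕ)))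
    (hl : l.Prime) (h11 : 11 ≤ l) (T : Cor22.ThetaVolumeDatumAt (ratPoint ((2 : ℚ)⁻¹ + 2 / 7 ^ k)) l) :
    (l ≤ L0 →
    letI := T.instFieldF; letI := T.instNumberFieldF; letI := T.instAlgebraF; letI := T.instFieldK
    letI := T.instNumberFieldK; letI := T.instAlgebraK; letI := T.instFieldFbar; letI := T.instAlgebraFbar
    letI := T.instAlgebraKFbar; letI := T.instIsElliptic
    ∀ (M : Type) [Field M] [NumberField M]
      (archPk : ∀ (j : (thetaIndex (pilotDataOfK T.D T.K)).Label) (vQ : (thetaIndex (pilotDataOfK T.D T.K)).VQ),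
        Set ((logShellsDH (pilotDataOfK T.D T.K) (analyticLogv T.K)).Packet j vQ))
      (archSub : ∀ (j : (thetaIndex (pilotDataOfK T.D T.K)).Label) (v : (thetaIndex (pilotDataOfK T.D T.K)).V),
        Set ((logShellsDH (pilotDataOfK T.D T.K) (analyticLogv T.K)).Packet j ((thetaIndex (pilotDataOfK T.D T.K)).over v)))
      (Ψ : ℤ → ∀ v : (thetaIndex (pilotDataOfK T.D T.K)).V, v ∈ (thetaIndex (pilotDataOfK T.D T.K)).Vbad →
        Set ((logShellsDH (pilotDataOfK T.D T.K) (analyticLogv T.K)).StarPacket v))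
      (act : ℤ → ∀ v : (thetaIndex (pilotDataOfK T.D T.K)).V, v ∈ (thetaIndex (pilotDataOfK T.D T.K)).Vbad →
        (logShellsDH (pilotDataOfK T.D T.K) (analyticLogv T.K)).StarPacket v →
          Module.End ℚ ((logShellsDH (pilotDataOfK T.D T.K) (analyticLogv T.K)).StarPacket v))
      (Mmod : ℤ → ∀ j : (thetaIndex (pilotDataOfK T.D T.K)).LabelStar, Set ((logShellsDH (pilotDataOfK T.D T.K) (analyticLogv T.K)).GlobalPacket j.1))
      (region : ℤ → ∀ j : (thetaIndex (pilotDataOfK T.D T.K)).LabelStar, FinDivisor M → ∀ vQ : (thetaIndex (pilotDataOfK T.D T.K)).VQ,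
        Set ((logShellsDH (pilotDataOfK T.D T.K) (analyticLogv T.K)).Packet j.1 vQ))
      (frobAdm : ℤ → ℤ → ∀ (j : (thetaIndex (pilotDataOfK T.D T.K)).Label) (vQ : (thetaIndex (pilotDataOfK T.D T.K)).VQ),
        Set ((logShellsDH (pilotDataOfK T.D T.K) (analyticLogv T.K)).Packet j vQ) → Prop)
      (frobLogvol : ℤ → ℤ → ∀ (j : (thetaIndex (pilotDataOfK T.D T.K)).Label) (vQ : (thetaIndex (pilotDataOfK T.D T.K)).VQ),
        Set ((logShellsDH (pilotDataOfK T.D T.K) (analyticLogv T.K)).Packet j vQ) → ℝ)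
      (frobΨ : ℤ → ℤ → ∀ v : (thetaIndex (pilotDataOfK T.D T.K)).V, v ∈ (thetaIndex (pilotDataOfK T.D T.K)).Vbad →
        Set ((logShellsDH (pilotDataOfK T.D T.K) (analyticLogv T.K)).StarPacket v))
      (frobMmod : ℤ → ℤ → ∀ j : (thetaIndex (pilotDataOfK T.D T.K)).LabelStar, Set ((logShellsDH (pilotDataOfK T.D T.K) (analyticLogv T.K)).GlobalPacket j.1))
      (unitImage : ℤ → ℤ → ℕ → ∀ (j : (thetaIndex (pilotDataOfK T.D T.K)).Label) (vQ : (thetaIndex (pilotDataOfK T.D T.K)).VQ),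
        Set ((logShellsDH (pilotDataOfK T.D T.K) (analyticLogv T.K)).Packet j vQ))
      (ballImage : ℤ → ℤ → ∀ (j : (thetaIndex (pilotDataOfK T.D T.K)).Label) (vQ : (thetaIndex (pilotDataOfK T.D T.K)).VQ),
        Set ((logShellsDH (pilotDataOfK T.D T.K) (analyticLogv T.K)).Packet j vQ))
      (thetaDiv : ℤ → ℤ → LgpDivisor M (thetaIndex (pilotDataOfK T.D T.K)).lstar)
      (n : ℤ) {HT : Type} {LogLink : HT → HT → Type} {IsFull : ∀ {s t : HT}, LogLink s t → Prop}
      (lat : LGPGaussianLogThetaLattice LogLink IsFull)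
      {Frd : Type} {IsoF : Frd → Frd → Type} {Ob : Frd → Type} {realify : Frd → Frd} {Strip : Type}
      {IsoS : Strip → Strip → Type} {Mv : ∀ v : (thetaIndex (pilotDataOfK T.D T.K)).V, v ∈ (thetaIndex (pilotDataOfK T.D T.K)).Vbad → Type}
      [∀ v h, Monoid (Mv v h)]
      (sig : GlobalLGPFrobenioidSignature (thetaIndex (pilotDataOfK T.D T.K)).lstar (thetaIndex (pilotDataOfK T.D T.K)).V
        (· ∈ (thetaIndex (pilotDataOfK T.D T.K)).Vbad) Frd IsoF Ob realify Strip IsoS Mv)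
      (split : SplittingMonoids Mv) {ObΔ : Type} {N : ∀ v : (thetaIndex (pilotDataOfK T.D T.K)).V, v ∈ (thetaIndex (pilotDataOfK T.D T.K)).Vbad → Type}
      [∀ v h, Monoid (N v h)] (qData : QPilotData ObΔ N)
      (qK : ∀ v : (thetaIndex (pilotDataOfK T.D T.K)).V, v ∈ (thetaIndex (pilotDataOfK T.D T.K)).Vbad →
        Set ((logShellsDH (pilotDataOfK T.D T.K) (analyticLogv T.K)).StarPacket v)),
      ¬ Cor312Vol.PilotKummerCompatHull
          (LatticeSituation.ofShells (logShellsDH (pilotDataOfK T.D T.K) (analyticLogv T.K)) M archPk archSub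
            (summandPiecesPr (pilotDataOfK T.D T.K) (logvAnalytic_analyticLogv (F := T.K))).Adm
            (summandPiecesPr (pilotDataOfK T.D T.K) (logvAnalytic_analyticLogv (F := T.K))).logvol Ψ act Mmod region frobAdm frobLogvol frobΨ
            frobMmod unitImage ballImage thetaDiv)
          (settingPrVolSharp (pilotDataOfK T.D T.K) (logvAnalytic_analyticLogv (F := T.K)) M archPk archSub Ψ act Mmod region n lat sig split qData
            (exists_realising_qIdeles_pilotDataOfK T.D).choose (exists_realising_thetaIdeles_pilotDataOfK T.D).choose
            (exists_realising_qIdeles_pilotDataOfK T.D).choose_spec.1 (exists_realising_qIdeles_pilotDataOfK T.D).choose_spec.2.1)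
          (fun _ => Cor312.Setting.qRegion
            (settingPrVolSharp (pilotDataOfK T.D T.K) (logvAnalytic_analyticLogv (F := T.K)) M archPk archSub Ψ act Mmod region n lat sig split qData
              (exists_realising_qIdeles_pilotDataOfK T.D).choose (exists_realising_thetaIdeles_pilotDataOfK T.D).choose
              (exists_realising_qIdeles_pilotDataOfK T.D).choose_spec.1 (exists_realising_qIdeles_pilotDataOfK T.D).choose_spec.2.1)) qK) ∧
    (Lp ≤ l →
    letI := T.instFieldF; letI := T.instNumberFieldF; letI := T.instAlgebraF; letI := T.instFieldK
    letI := T.instNumberFieldK; letI := T.instAlgebraK; letI := T.instFieldFbar; letI := T.instAlgebraFbar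
    letI := T.instAlgebraKFbar; letI := T.instIsElliptic
    ∀ {logv : PadicLogs T.K} (hlog : LogvAnalytic logv) (M : Type) [Field M] [NumberField M]
      (archPk : ∀ (j : (thetaIndex (pilotDataOfK T.D T.K)).Label) (vQ : (thetaIndex (pilotDataOfK T.D T.K)).VQ),
        Set ((logShellsDH (pilotDataOfK T.D T.K) logv).Packet j vQ))
      (archSub : ∀ (j : (thetaIndex (pilotDataOfK T.D T.K)).Label) (v : (thetaIndex (pilotDataOfK T.D T.K)).V),
        Set ((logShellsDH (pilotDataOfK T.D T.K) logv).Packet j ((thetaIndex (pilotDataOfK T.D T.K)).over v)))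
      (Ψ : ℤ → ∀ v : (thetaIndex (pilotDataOfK T.D T.K)).V, v ∈ (thetaIndex (pilotDataOfK T.D T.K)).Vbad →
        Set ((logShellsDH (pilotDataOfK T.D T.K) logv).StarPacket v))
      (act : ℤ → ∀ v : (thetaIndex (pilotDataOfK T.D T.K)).V, v ∈ (thetaIndex (pilotDataOfK T.D T.K)).Vbad →
        (logShellsDH (pilotDataOfK T.D T.K) logv).StarPacket v → Module.End ℚ ((logShellsDH (pilotDataOfK T.D T.K) logv).StarPacket v))
      (Mmod : ℤ → ∀ j : (thetaIndex (pilotDataOfK T.D T.K)).LabelStar, Set ((logShellsDH (pilotDataOfK T.D T.K) logv).GlobalPacket j.1))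
      (region : ℤ → ∀ j : (thetaIndex (pilotDataOfK T.D T.K)).LabelStar, FinDivisor M → ∀ vQ : (thetaIndex (pilotDataOfK T.D T.K)).VQ,
        Set ((logShellsDH (pilotDataOfK T.D T.K) logv).Packet j.1 vQ))
      (n : ℤ) {HT : Type} {LogLink : HT → HT → Type} {IsFull : ∀ {s t : HT}, LogLink s t → Prop}
      (lat : LGPGaussianLogThetaLattice LogLink IsFull)
      {Frd : Type} {IsoF : Frd → Frd → Type} {Ob : Frd → Type} {realify : Frd → Frd} {Strip : Type}
      {IsoS : Strip → Strip → Type} {Mv : ∀ v : (thetaIndex (pilotDataOfK T.D T.K)).V, v ∈ (thetaIndex (pilotDataOfK T.D T.K)).Vbad → Type}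
      [∀ v h, Monoid (Mv v h)]
      (sig : GlobalLGPFrobenioidSignature (thetaIndex (pilotDataOfK T.D T.K)).lstar (thetaIndex (pilotDataOfK T.D T.K)).V
        (· ∈ (thetaIndex (pilotDataOfK T.D T.K)).Vbad) Frd IsoF Ob realify Strip IsoS Mv)
      (split : SplittingMonoids Mv) {ObΔ : Type} {N : ∀ v : (thetaIndex (pilotDataOfK T.D T.K)).V, v ∈ (thetaIndex (pilotDataOfK T.D T.K)).Vbad → Type}
      [∀ v h, Monoid (N v h)] (qData : QPilotData ObΔ N)
      (tq : ∀ (pp : Nat.Primes) (x : (thetaIndex (pilotDataOfK T.D T.K)).Fibre (.inr pp)),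
        haveI : Fact (pp : ℕ).Prime := ⟨pp.2⟩; kOf (pilotDataOfK T.D T.K) pp.1 x)
      (t : ∀ (pp : Nat.Primes) (_ : Fin (pilotDataOfK T.D T.K).lstar) (x : (thetaIndex (pilotDataOfK T.D T.K)).Fibre (.inr pp)),
        haveI : Fact (pp : ℕ).Prime := ⟨pp.2⟩; kOf (pilotDataOfK T.D T.K) pp.1 x)
      (htq0 : ∀ pp x, tq pp x ≠ 0)
      (htq1 : ∀ (pp : Nat.Primes) (x : (thetaIndex (pilotDataOfK T.D T.K)).Fibre (.inr pp)),
        haveI : Fact (pp : ℕ).Prime := ⟨pp.2⟩; placeOf (pilotDataOfK T.D T.K) pp.1 x ∉ (pilotDataOfK T.D T.K).S → ‖tq pp x‖ = 1)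
      (_ht0 : ∀ pp i x, t pp i x ≠ 0)
      (_ht : ∀ (pp : Nat.Primes) (i : Fin (pilotDataOfK T.D T.K).lstar) (x : (thetaIndex (pilotDataOfK T.D T.K)).Fibre (.inr pp)),
        haveI : Fact (pp : ℕ).Prime := ⟨pp.2⟩
        Real.log ‖t pp i x‖ = -((pilotDataOfK T.D T.K).thetaPilot i (placeOf (pilotDataOfK T.D T.K) pp.1 x)) *
          logNorm T.K (placeOf (pilotDataOfK T.D T.K) pp.1 x) / localDegree T.K (placeOf (pilotDataOfK T.D T.K) pp.1 x))
      (_htq : ∀ (pp : Nat.Primes) (x : (thetaIndex (pilotDataOfK T.D T.K)).Fibre (.inr pp)),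
        haveI : Fact (pp : ℕ).Prime := ⟨pp.2⟩
        Real.log ‖tq pp x‖ = -((pilotDataOfK T.D T.K).qPilot (placeOf (pilotDataOfK T.D T.K) pp.1 x)) *
          logNorm T.K (placeOf (pilotDataOfK T.D T.K) pp.1 x) / localDegree T.K (placeOf (pilotDataOfK T.D T.K) pp.1 x)),
      Thm311ToCor312.Licence
        (settingPrVolSharp (pilotDataOfK T.D T.K) hlog M archPk archSub Ψ act Mmod region n lat sig split qData tq t htq0 htq1)) := by
  simp only [List.mem_cons, Prod.mk.injEq, List.not_mem_nil, or_false] at hmem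
  rcases hmem with ⟨rfl, rfl, rfl⟩ | ⟨rfl, rfl, rfl⟩ | ⟨rfl, rfl, rfl⟩ | ⟨rfl, rfl, rfl⟩ | ⟨rfl, rfl, rfl⟩ | ⟨rfl, rfl, rfl⟩ | ⟨rfl, rfl, rfl⟩ | ⟨rfl, rfl, rfl⟩ | ⟨rfl, rfl, rfl⟩ | ⟨rfl, rfl, rfl⟩ | ⟨rfl, rfl, rfl⟩ | ⟨rfl, rfl, rfl⟩ | ⟨rfl, rfl, rfl⟩ | ⟨rfl, rfl, rfl⟩ | ⟨rfl, rfl, rfl⟩ | ⟨rfl, rfl, rfl⟩ | ⟨rfl, rfl, rfl⟩ | ⟨rfl, rfl, rfl⟩ | ⟨rfl, rfl, rfl⟩ | ⟨rfl, rfl, rfl⟩ | ⟨rfl, rfl, rfl⟩ | ⟨rfl, rfl, rfl⟩ | ⟨rfl, rfl, rfl⟩ | ⟨rfl, rfl, rfl⟩ | ⟨rfl, rfl, rfl⟩ | ⟨rfl, rfl, rfl⟩ | ⟨rfl, rfl, rfl⟩ | ⟨rfl, rfl, rfl⟩ | ⟨rfl, rfl, rfl⟩ | ⟨rfl, rfl,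 rfl⟩ | ⟨rfl, rfl, rfl⟩ | ⟨rfl, rfl, rfl⟩ | ⟨rfl, rfl, rfl⟩ | ⟨rfl, rfl, rfl⟩ | ⟨rfl, rfl, rfl⟩ | ⟨rfl, rfl, rfl⟩ | ⟨rfl, rfl, rfl⟩ | ⟨rfl, rfl, rfl⟩ | ⟨rfl, rfl, rfl⟩ | ⟨rfl, rfl, rfl⟩
  · exact WRow.hex_whole_le_24 (by decide) hl h11 T  -- k = 1
  · exact WRow.hex_whole_le_24 (by decide) hl h11 T  -- k = 2
  · exact WRow.hex_whole_le_24 (by decide) hl h11 T  -- k = 3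
  · exact WRow.hex_whole_le_24 (by decide) hl h11 T  -- k = 4
  · exact WRow.hex_whole_le_24 (by decide) hl h11 T  -- k = 5
  · exact WRow.hex_whole_le_24 (by decide) hl h11 T  -- k = 6
  · exact WRow.hex_whole_le_24 (by decide) hl h11 T  -- k = 7
  · exact WRow.hex_whole_le_24 (by decide) hl h11 T  -- k = 8
  · exact WRow.hex_whole_le_24 (by decide) hl h11 T  -- k = 9
  · exact WRow.hex_whole_le_24 (by decide) hl h11 T  -- k = 10
  · exact WRow.hex_whole_le_24 (by decide) hl h11 T  -- k = 11
  · exact WRow.hex_whole_le_24 (by decide) hl h11 T  -- k = 12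
  · exact WRow.hex_whole_le_24 (by decide) hl h11 T  -- k = 13
  · exact WRow.hex_whole_le_24 (by decide) hl h11 T  -- k = 14
  · exact WRow.hex_whole_le_24 (by decide) hl h11 T  -- k = 15
  · exact WRow.hex_whole_le_24 (by decide) hl h11 T  -- k = 16
  · exact WRow.hex_whole_le_24 (by decide) hl h11 T  -- k = 17
  · exact WRow.hex_whole_le_24 (by decide) hl h11 T  -- k = 18
  · exact WRow.hex_whole_le_24 (by decide) hl h11 T  -- k = 19
  · exact WRow.hex_whole_le_24 (by decide) hl h11 T  -- k = 20
  · exact WRow.hex_whole_le_24 (by decide) hl h11 T  -- k = 21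
  · exact WRow.hex_whole_le_24 (by decide) hl h11 T  -- k = 22
  · exact WRow.hex_whole_le_24 (by decide) hl h11 T  -- k = 23
  · exact WRow.hex_whole_le_24 (by decide) hl h11 T  -- k = 24
  · -- k = 25: (L₀, L⁺) = (3460321741, 3460321747)
    refine ⟨fun hL0 => ?_, fun hLp => ?_⟩
    · exact GenuineK.not_pilotKummerCompatHull_chosen_lamSeven_twentyFive_le rfl hl h11 hL0 T
    · exact WRow.licence_lamSeven_twentyFive_all rfl hl hLp T
  · -- k = 26: (L₀, L⁺) = (5536514639, 5536514681)
    refine ⟨fun hL0 => ?_, fun hLp => ?_⟩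
    · exact GenuineK.not_pilotKummerCompatHull_chosen_lamSeven_twentySix_le rfl hl h11 hL0 T
    · exact WRow.licence_lamSeven_twentySix_all rfl hl hLp T
  · -- k = 27: (L₀, L⁺) = (14533351453, 14533351507)
    refine ⟨fun hL0 => ?_, fun hLp => ?_⟩
    · exact GenuineK.not_pilotKummerCompatHull_chosen_lamSeven_twentySeven_le rfl hl h11 hL0 T
    · exact WRow.licence_lamSeven_twentySeven_all rfl hl hLp T
  · -- k = 28: (L₀, L⁺) = (38755603903, 38755603927)
    refine ⟨fun hL0 => ?_, fun hLp => ?_⟩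
    · exact GenuineK.not_pilotKummerCompatHull_chosen_lamSeven_twentyEight_le rfl hl h11 hL0 T
    · exact WRow.licence_lamSeven_twentyEight_all rfl hl hLp T
  · -- k = 29: (L₀, L⁺) = (33911153561, 33911153599)
    refine ⟨fun hL0 => ?_, fun hLp => ?_⟩
    · exact GenuineK.not_pilotKummerCompatHull_chosen_lamSeven_twentyNine_le rfl hl h11 hL0 T
    · exact WRow.licence_lamSeven_twentyNine_all rfl hl hLp T
  · -- k = 30: (L₀, L⁺) = (4069338436799, 4069338436831)
    refine ⟨fun hL0 => ?_, fun hLp => ?_⟩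
    · exact GenuineK.not_pilotKummerCompatHull_chosen_lamSeven_thirty_le rfl hl h11 hL0 T
    · by_cases hlv : l = 4069338436831
      · exact WRow.licence_lamSeven_thirty_level4069338436831 rfl hlv T
      · rcases Nat.lt_or_ge l 4069338436847 with hlt | hge
        · exfalso
          have hv : l = 4069338436832 ∨ l = 4069338436833 ∨ l = 4069338436834 ∨ l = 4069338436835 ∨ l = 4069338436836 ∨ l = 4069338436837 ∨ l = 4069338436838 ∨ l = 4069338436839 ∨ l = 4069338436840 ∨ l = 4069338436841 ∨ l = 4069338436842 ∨ l = 4069338436843 ∨ l = 4069338436844 ∨ l = 4069338436845 ∨ l = 4069338436846 := by omega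
          rcases hv with rfl | rfl | rfl | rfl | rfl | rfl | rfl | rfl | rfl | rfl | rfl | rfl | rfl | rfl | rfl
          · exact absurd hl (by rw [show (4069338436832 : ℕ) = 2 * 2034669218416 by norm_num]; exact Nat.not_prime_mul (by norm_num) (by norm_num))
          · exact absurd hl (by rw [show (4069338436833 : ℕ) = 3 * 1356446145611 by norm_num]; exact Nat.not_prime_mul (by norm_num) (by norm_num))
          · exact absurd hl (by rw [show (4069338436834 : ℕ) = 2 * 2034669218417 by norm_num]; exact Nat.not_prime_mul (by norm_num) (by norm_num))
          · exact absurd hl (by rw [show (4069338436835 : ℕ) = 5 * 813867687367 by norm_num]; exact Nat.not_prime_mul (by norm_num) (by norm_num))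
          · exact absurd hl (by rw [show (4069338436836 : ℕ) = 2 * 2034669218418 by norm_num]; exact Nat.not_prime_mul (by norm_num) (by norm_num))
          · exact absurd hl (by rw [show (4069338436837 : ℕ) = 521 * 7810630397 by norm_num]; exact Nat.not_prime_mul (by norm_num) (by norm_num))
          · exact absurd hl (by rw [show (4069338436838 : ℕ) = 2 * 2034669218419 by norm_num]; exact Nat.not_prime_mul (by norm_num) (by norm_num))
          · exact absurd hl (by rw [show (4069338436839 : ℕ) = 3 * 1356446145613 by norm_num]; exact Nat.not_prime_mul (by norm_num) (by norm_num))
          · exact absurd hl (by rw [show (4069338436840 : ℕ) = 2 * 2034669218420 by norm_num]; exact Nat.not_prime_mul (by norm_num) (by norm_num))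
          · exact absurd hl (by rw [show (4069338436841 : ℕ) = 71 * 57314625871 by norm_num]; exact Nat.not_prime_mul (by norm_num) (by norm_num))
          · exact absurd hl (by rw [show (4069338436842 : ℕ) = 2 * 2034669218421 by norm_num]; exact Nat.not_prime_mul (by norm_num) (by norm_num))
          · exact absurd hl (by rw [show (4069338436843 : ℕ) = 43 * 94635777601 by norm_num]; exact Nat.not_prime_mul (by norm_num) (by norm_num))
          · exact absurd hl (by rw [show (4069338436844 : ℕ) = 2 * 2034669218422 by norm_num]; exact Nat.not_prime_mul (by norm_num) (by norm_num))
          · exact absurd hl (by rw [show (4069338436845 : ℕ) = 3 * 1356446145615 by norm_num]; exact Nat.not_prime_mul (by norm_num) (by norm_num))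
          · exact absurd hl (by rw [show (4069338436846 : ℕ) = 2 * 2034669218423 by norm_num]; exact Nat.not_prime_mul (by norm_num) (by norm_num))
        · exact WRow.licence_lamSeven_thirty_all rfl hl hge T
  · -- k = 31: (L₀, L⁺) = (237378075419, 237378075439)
    refine ⟨fun hL0 => ?_, fun hLp => ?_⟩
    · exact GenuineK.not_pilotKummerCompatHull_chosen_lamSeven_thirtyOne_le rfl hl h11 hL0 T
    · exact WRow.licence_lamSeven_thirtyOne_all rfl hl hLp T
  · -- k = 32: (L₀, L⁺) = (1899024603689, 1899024603703)
    refine ⟨fun hL0 => ?_, fun hLp => ?_⟩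
    · exact GenuineK.not_pilotKummerCompatHull_chosen_lamSeven_thirtyTwo_le rfl hl h11 hL0 T
    · exact WRow.licence_lamSeven_thirtyTwo_all rfl hl hLp T
  · -- k = 33: (L₀, L⁺) = (4984939585357, 4984939585387)
    refine ⟨fun hL0 => ?_, fun hLp => ?_⟩
    · exact GenuineK.not_pilotKummerCompatHull_chosen_lamSeven_thirtyThree_le rfl hl h11 hL0 T
    · exact WRow.licence_lamSeven_thirtyThree_all rfl hl hLp T
  · -- k = 34: (L₀, L⁺) = (13293172227497, 13293172227557)
    refine ⟨fun hL0 => ?_, fun hLp => ?_⟩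
    · exact GenuineK.not_pilotKummerCompatHull_chosen_lamSeven_thirtyFour_le rfl hl h11 hL0 T
    · exact WRow.licence_lamSeven_thirtyFour_all rfl hl hLp T
  · -- k = 35: (L₀, L⁺) = (58157628496679, 58157628496739)
    refine ⟨fun hL0 => ?_, fun hLp => ?_⟩
    · exact GenuineK.not_pilotKummerCompatHull_chosen_lamSeven_thirtyFive_le rfl hl h11 hL0 T
    · exact WRow.licence_lamSeven_thirtyFive_all rfl hl hLp T
  · -- k = 36: (L₀, L⁺) = (279156616784327, 279156616784387)
    refine ⟨fun hL0 => ?_, fun hLp => ?_⟩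
    · exact GenuineK.not_pilotKummerCompatHull_chosen_lamSeven_thirtySix_le rfl hl h11 hL0 T
    · exact WRow.licence_lamSeven_thirtySix_all rfl hl hLp T
  · -- k = 37: (L₀, L⁺) = (81420679895431, 81420679895459)
    refine ⟨fun hL0 => ?_, fun hLp => ?_⟩
    · exact GenuineK.not_pilotKummerCompatHull_chosen_lamSeven_thirtySeven_le rfl hl h11 hL0 T
    · exact WRow.licence_lamSeven_thirtySeven_all rfl hl hLp T
  · -- k = 38: (L₀, L⁺) = (651365439163823, 651365439163849)
    refine ⟨fun hL0 => ?_, fun hLp => ?_⟩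
    · exact GenuineK.not_pilotKummerCompatHull_chosen_lamSeven_thirtyEight_le rfl hl h11 hL0 T
    · exact WRow.licence_lamSeven_thirtyEight_all rfl hl hLp T
  · -- k = 39: (L₀, L⁺) = (1709834277805873, 1709834277805961)
    refine ⟨fun hL0 => ?_, fun hLp => ?_⟩
    · exact GenuineK.not_pilotKummerCompatHull_chosen_lamSeven_thirtyNine_le rfl hl h11 hL0 T
    · exact WRow.licence_lamSeven_thirtyNine_all rfl hl hLp T
  · -- k = 40: (L₀, L⁺) = (22797790370745883, 22797790370745947)
    refine ⟨fun hL0 => ?_, fun hLp => ?_⟩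
    · exact GenuineK.not_pilotKummerCompatHull_chosen_lamSeven_forty_le rfl hl h11 hL0 T
    · exact WRow.licence_lamSeven_forty_all rfl hl hLp T

end Summit.ABC.IUTFork.Conditional

end
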